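import Literature.NumberTheory.ModularForms.Lemma49Plus8G
import HarnessLib

/-!
# CKMRV Lemma 4.9 (4.15), (4.17) for `𝒦₋^{(8)}` (`γ ∈ {I, T, TS}`)

Cohn–Kumar–Miller–Radchenko–Viazovska, arXiv:1902.05438, Lemma 4.9 with `n_{−,τ} = 1`, `n_{−,z} = 1`,
`n̂_τ^{(8)} = 2`: for `Im τ, Im z ≥ δ`,
(4.15) `|(𝒦₋^{(8)}|^τ_4 γ|^z_{−2}S)(τ,z)| ≤ C|e^{πi(τ + z)}τ²z²/(Δ(τ)Δ(z)(j(τ)−j(z)))|`,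
(4.17) `|(𝒦₋^{(8)}|^z_{−2}S)(τ,z)| ≤ C|e^{πi(2τ + z)}τ²z²/(Δ(τ)Δ(z)(j(τ)−j(z)))|`.

With rows `(1, R₂, R₄)` (`R = ψ|γ`: `ψ|T = ψ + πiξ`, `ψ|TS = ψ + πi(ξ|S)`) the `S`-twisted,
multiplied-out kernel is
`L_R = c[−2𝔠E₄Δ(τ)·E₁₀𝓛_S(z) + R₂E₁₄(τ)·g(z) − 𝔠R₄Δ(τ)·E₈V(z) − R₄E₄³(τ)·g(z)]`,
`g = −E₈V − E₆(U² − W²)` (using `𝓛(Sz) = 𝓛_S(z)`, `W(Sz) = −z²V(z)`, `U(Sz) = −z²U(z)`, `V(Sz) = −z²W(z)`):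
every `z`-factor is `O(e^{−π Im z})` and `R₂E₁₄ − R₄E₄³ = (R₂ − R₄)E₁₄ + R₄(E₁₄ − E₄³)`, with
`ψ₂ − ψ₄ = O(|τ|q)`, `ξ₂ − ξ₄ = O(b²)`, `ξ₂|S − ξ₄|S = O(b)`, `E₁₄ − E₄³, Δ = O(q)`. All proved:
uniform theta/`𝓛` facts on half-planes (`halfPlane_isBigO_theta`), the identity and the bounds
`kernelMinus8_S_bound_417`, `kernelMinus8_S_bound_415 (γ = 1, T, TS)`.

## References

* H. Cohn, A. Kumar, S. D. Miller, D. Radchenko, M. Viazovska, Ann. of Math. 196 (2022),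
  arXiv:1902.05438, Lemma 4.9 (4.15), (4.17). [CohnEtAl2019]
-/

noncomputable section

open Complex hiding I
open Filter Topology Asymptotics ModularForm SlashInvariantForm EisensteinSeries
open UpperHalfPlane hiding I
open Complex (I)
open scoped Real MatrixGroups ModularForm Manifold

namespace Literature.NumberTheory.ModularForms

open Literature.NumberTheory.EllipticCurves.ModularForms (kleinJ kleinJ_smul E₄_cube_eq_kleinJ_mul)

/-! ## `S`-laws for `U, V, W, 𝓛` -/

/-- `U(Sz) = −z²U(z)`, `V(Sz) = −z²W(z)`, `W(Sz) = −z²V(z)`. [cite: CohnEtAl2019, §2.1.2] -/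
theorem thetaUVW_S_smul (z : ℍ) :
    thetaU (ModularGroup.S • z) = -(z : ℂ) ^ 2 * thetaU z ∧ thetaV (ModularGroup.S • z) = -(z : ℂ) ^ 2 * thetaW z ∧
      thetaW (ModularGroup.S • z) = -(z : ℂ) ^ 2 * thetaV z := by
  have hz : (z : ℂ) ≠ 0 := z.ne_zero
  have key : ∀ {f g : ℍ → ℂ}, f ∣[(2 : ℤ)] ModularGroup.S = -g → f (ModularGroup.S • z) = -(z : ℂ) ^ 2 * g z := by
    intro f g h
    have := congrFun h z
    rw [slash_S_apply', Pi.neg_apply] at this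
    rw [zpow_neg, zpow_ofNat] at this
    field_simp at this
    linear_combination this
  exact ⟨key thetaU_slash_S, key thetaV_slash_S, key thetaW_slash_S⟩

/-! ## The row-parametrised minus kernel -/

/-- `𝒦₋^{(8)}` with rows `(1, R₂, R₄)` in place of `(ψ₀, ψ₂, ψ₄)`. [cite: CohnEtAl2019, §4.4 (4.13)] -/
def minus8Kernel (R2 R4 : ℍ → ℂ) (τ z : ℍ) : ℂ :=
  1 / (2 * 1728 * (π : ℂ)) / (ModularForm.discriminant z * (kleinJ τ - kleinJ z)) *
    (E₄ τ * (-2 * 1728 * E10fun z * psiTilde0 z) +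
      R2 τ * f2fun τ * (E8fun z * psiTilde2 z - E₆ z * psiTilde4 z) +
      R4 τ * ((1728 - kleinJ τ) * E8fun z * psiTilde2 z + kleinJ τ * E₆ z * psiTilde4 z))

/-- `kernelMinus8_eq_minus8Kernel` (auxiliary). [cite: CohnEtAl2019, Lemma 4.9 (proof)] -/
theorem kernelMinus8_eq_minus8Kernel : kernelMinus8 = minus8Kernel psi2 psi4 := rfl

/-- Slashing acts on the rows (weights `2`, `4`). [cite: CohnEtAl2019, §4.4] -/
theorem minus8Kernel_slash (R2 R4 : ℍ → ℂ) (z : ℍ) (γ : SL(2, ℤ)) :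
    (fun τ => minus8Kernel R2 R4 τ z) ∣[(4 : ℤ)] γ = fun τ => minus8Kernel (R2 ∣[(2 : ℤ)] γ) (R4 ∣[(4 : ℤ)] γ) τ z := by
  set c : ℂ := 1 / (2 * 1728 * (π : ℂ)) with hc
  set a₁ : ℍ → ℂ := ⇑E₄ * fun τ => c / (ModularForm.discriminant z * (kleinJ τ - kleinJ z)) *
    (-2 * 1728 * E10fun z * psiTilde0 z) with ha₁
  set a₂ : ℍ → ℂ := f2fun * fun τ => c / (ModularForm.discriminant z * (kleinJ τ - kleinJ z)) *
    (E8fun z * psiTilde2 z - E₆ z * psiTilde4 z) with ha₂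
  set a₃ : ℍ → ℂ := fun τ => c / (ModularForm.discriminant z * (kleinJ τ - kleinJ z)) *
    ((1728 - kleinJ τ) * E8fun z * psiTilde2 z + kleinJ τ * E₆ z * psiTilde4 z) with ha₃
  have h₁ : IsLevelOneInvariant 4 a₁ :=
    (isLevelOneInvariant_E₄.mul (isLevelOneInvariant_comp_kleinJ fun j =>
      c / (ModularForm.discriminant z * (j - kleinJ z)) * (-2 * 1728 * E10fun z * psiTilde0 z))).cast (by norm_num)
  have h₂ : IsLevelOneInvariant (4 - 2) a₂ :=
    (isLevelOneInvariant_f2.mul (isLevelOneInvariant_comp_kleinJ fun j =>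
      c / (ModularForm.discriminant z * (j - kleinJ z)) * (E8fun z * psiTilde2 z - E₆ z * psiTilde4 z))).cast (by norm_num)
  have h₃ : IsLevelOneInvariant (4 - 4) a₃ :=
    (isLevelOneInvariant_comp_kleinJ fun j => c / (ModularForm.discriminant z * (j - kleinJ z)) *
      ((1728 - j) * E8fun z * psiTilde2 z + j * E₆ z * psiTilde4 z)).cast (by norm_num)
  have key : ∀ (S2 S4 : ℍ → ℂ), (fun τ => minus8Kernel S2 S4 τ z) = a₁ + S2 * a₂ + S4 * a₃ := by
    intro S2 S4; funext τ
    simp only [minus8Kernel, ha₁, ha₂, ha₃, hc, Pi.add_apply, Pi.mul_apply]; ring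
  rw [key, key, SlashAction.add_slash, SlashAction.add_slash, h₁ γ, show (4 : ℤ) = 2 + (4 - 2) by norm_num,
    mul_slash_SL2, h₂ γ, show (2 : ℤ) + (4 - 2) = 4 + (4 - 4) by norm_num, mul_slash_SL2, h₃ γ,
    show (4 : ℤ) + (4 - 4) = 4 by norm_num]

/-! ## The multiplied-out `S`-twist -/

/-- `L_R = c[−2𝔠E₄Δ(τ)E₁₀𝓛_S(z) + R₂E₁₄(τ)g(z) − 𝔠R₄Δ(τ)E₈V(z) − R₄E₄³(τ)g(z)]`, `g = −E₈V − E₆(U² − W²)`.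
[cite: CohnEtAl2019, Lemma 4.9 (proof)] -/
def minus8SBracket (R2 R4 : ℍ → ℂ) (τ z : ℍ) : ℂ :=
  1 / (2 * 1728 * (π : ℂ)) *
    (-2 * 1728 * E₄ τ * ModularForm.discriminant τ * (E10fun z * logLambdaS z)
      + R2 τ * E14fun τ * (-(E8fun z * thetaV z) - E₆ z * (thetaU z ^ 2 - thetaW z ^ 2))
      - 1728 * R4 τ * ModularForm.discriminant τ * (E8fun z * thetaV z)
      - R4 τ * E₄ τ ^ 3 * (-(E8fun z * thetaV z) - E₆ z * (thetaU z ^ 2 - thetaW z ^ 2)))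

/-- `minus8Kernel_S_mul_eq` (auxiliary). [cite: CohnEtAl2019, Lemma 4.9 (proof)] -/
theorem minus8Kernel_S_mul_eq (R2 R4 : ℍ → ℂ) (τ z : ℍ) (hJ : kleinJ τ - kleinJ z ≠ 0) :
    minus8Kernel R2 R4 τ (ModularGroup.S • z) * (z : ℂ) ^ 2 *
      (ModularForm.discriminant τ * ModularForm.discriminant z * (kleinJ τ - kleinJ z)) = minus8SBracket R2 R4 τ z := by
  have hz : (z : ℂ) ≠ 0 := z.ne_zero
  have hΔz := ModularForm.discriminant_ne_zero z
  have hΔτ := ModularForm.discriminant_ne_zero τ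
  obtain ⟨hU, hV, hW⟩ := thetaUVW_S_smul z
  have hjτ : kleinJ τ * ModularForm.discriminant τ = E₄ τ ^ 3 := (E₄_cube_eq_kleinJ_mul τ).symm
  simp only [minus8Kernel, minus8SBracket, kleinJ_smul, discriminant_S_smul', psiTilde0, psiTilde2, psiTilde4, logLambda_S_smul,
    E8fun, E10fun, E14fun, f2fun, Pi.mul_apply, Pi.sub_apply, Pi.inv_apply, E₄_S_smul, E₆_S_smul, hU, hV, hW]
  field_simp
  have e1 : kleinJ τ = E₄ τ ^ 3 / ModularForm.discriminant τ := by rw [eq_div_iff hΔτ]; exact hjτ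
  rw [e1]
  field_simp
  ring

/-- `norm_minus8Kernel_S_mul_le` (auxiliary). [cite: CohnEtAl2019, Lemma 4.9 (proof)] -/
theorem norm_minus8Kernel_S_mul_le (R2 R4 : ℍ → ℂ) (τ z : ℍ) :
    ‖minus8Kernel R2 R4 τ (ModularGroup.S • z) * (z : ℂ) ^ 2 *
      (ModularForm.discriminant τ * ModularForm.discriminant z * (kleinJ τ - kleinJ z))‖ ≤ ‖minus8SBracket R2 R4 τ z‖ := by
  by_cases hJ : kleinJ τ - kleinJ z = 0
  · rw [hJ]; simp
  · rw [minus8Kernel_S_mul_eq R2 R4 τ z hJ]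

/-- Decomposition: `L_R = c[−2𝔠E₄Δ(τ)E₁₀𝓛_S(z) − 𝔠R₄Δ(τ)E₈V(z) + ((R₂ − R₄)E₁₄ + R₄(E₁₄ − E₄³))(τ)·g(z)]`.
[cite: CohnEtAl2019, Lemma 4.9 (proof)] -/
theorem minus8SBracket_decomp (R2 R4 : ℍ → ℂ) (τ z : ℍ) : minus8SBracket R2 R4 τ z = 1 / (2 * 1728 * (π : ℂ)) *
    ( -2 * 1728 * (E₄ τ * ModularForm.discriminant τ) * (E10fun z * logLambdaS z)
      - 1728 * (R4 τ * ModularForm.discriminant τ) * (E8fun z * thetaV z)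
      + ((R2 τ - R4 τ) * E14fun τ + R4 τ * (E14fun τ - E₄ τ ^ 3)) *
          (-(E8fun z * thetaV z) - E₆ z * ((thetaU z - thetaW z) * (thetaU z + thetaW z))) ) := by
  simp only [minus8SBracket]; ring

/-! ## Uniform theta/`𝓛` facts on half-planes -/

/-- On `Im τ ≥ δ`: `U, W, ξ₂, ξ₄, ξ₂|S, ξ₄|S, M = O(1)`, `V, U − W, 𝓛_S, ξ₂|S − ξ₄|S = O(b)`, `ξ₂ − ξ₄ = O(b²)`,
`E₁₄ − E₄³ = O(b⁴)` (`b = e^{−π Im τ}`). [cite: CohnEtAl2019, §2.1.2, Lemma 4.9 (proof)] -/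
theorem halfPlane_isBigO_theta {δ : ℝ} (hδ : 0 < δ) :
    (thetaU =O[𝓟 (halfPlane δ)] fun _ : ℍ => (1 : ℝ)) ∧ (thetaW =O[𝓟 (halfPlane δ)] fun _ : ℍ => (1 : ℝ)) ∧
    (thetaV =O[𝓟 (halfPlane δ)] expDecayHalf) ∧
    ((fun τ => thetaU τ - thetaW τ) =O[𝓟 (halfPlane δ)] expDecayHalf) ∧
    (logLambdaS =O[𝓟 (halfPlane δ)] expDecayHalf) ∧
    (logLambdaPer =O[𝓟 (halfPlane δ)] fun _ : ℍ => (1 : ℝ)) ∧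
    ((fun τ => xi2 τ - xi4 τ) =O[𝓟 (halfPlane δ)] fun τ => expDecayHalf τ ^ 2) ∧
    ((fun τ => xi2S τ - xi4S τ) =O[𝓟 (halfPlane δ)] expDecayHalf) ∧
    (xi2 =O[𝓟 (halfPlane δ)] fun _ : ℍ => (1 : ℝ)) ∧ (xi4 =O[𝓟 (halfPlane δ)] fun _ : ℍ => (1 : ℝ)) ∧
    (xi2S =O[𝓟 (halfPlane δ)] fun _ : ℍ => (1 : ℝ)) ∧ (xi4S =O[𝓟 (halfPlane δ)] fun _ : ℍ => (1 : ℝ)) := by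
  obtain ⟨⟨CU, hU⟩, ⟨CW, hW⟩, ⟨CV, hV⟩⟩ := thetaUVW_uniform hδ
  obtain ⟨⟨CS, hS⟩, ⟨CM, hM⟩⟩ := logLambda_uniform hδ
  have mk : ∀ {f : ℍ → ℂ} {g : ℍ → ℝ} (C : ℝ), (∀ τ : ℍ, δ ≤ τ.im → ‖f τ‖ ≤ C * g τ) → (∀ τ, 0 ≤ g τ) →
      f =O[𝓟 (halfPlane δ)] g := by
    intro f g C h hg
    rw [isBigO_principal]
    exact ⟨C, fun τ hτ => by rw [Real.norm_of_nonneg (hg τ)]; exact h τ hτ⟩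
  have hb0 : ∀ τ : ℍ, 0 ≤ expDecayHalf τ := fun τ => (expDecayHalf_pos τ).le
  -- remainders
  have rU : (fun τ => thetaU τ - 1 - 8 * qhalf τ - 24 * qhalf τ ^ 2 - 32 * qhalf τ ^ 3) =O[𝓟 (halfPlane δ)] fun τ => expDecayHalf τ ^ 4 :=
    mk CU hU fun τ => pow_nonneg (hb0 τ) 4
  have rW : (fun τ => thetaW τ - 1 + 8 * qhalf τ - 24 * qhalf τ ^ 2 + 32 * qhalf τ ^ 3) =O[𝓟 (halfPlane δ)] fun τ => expDecayHalf τ ^ 4 :=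
    mk CW hW fun τ => pow_nonneg (hb0 τ) 4
  have rV : (fun τ => thetaV τ - 16 * qhalf τ - 64 * qhalf τ ^ 3) =O[𝓟 (halfPlane δ)] fun τ => expDecayHalf τ ^ 5 :=
    mk CV hV fun τ => pow_nonneg (hb0 τ) 5
  have rS : (fun τ => logLambdaS τ + 16 * qhalf τ) =O[𝓟 (halfPlane δ)] fun τ => expDecayHalf τ ^ 3 :=
    mk CS hS fun τ => pow_nonneg (hb0 τ) 3
  have rM : (fun τ => logLambdaPer τ - (Real.log 16 : ℝ) + 8 * qhalf τ - 12 * qhalf τ ^ 2) =O[𝓟 (halfPlane δ)]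
      fun τ => expDecayHalf τ ^ 3 := mk CM hM fun τ => pow_nonneg (hb0 τ) 3
  -- basic comparison functions on the half-plane
  have hq : qhalf =O[𝓟 (halfPlane δ)] expDecayHalf := mk 1 (fun τ _ => by rw [norm_qhalf, one_mul]) hb0
  have hb1 : expDecayHalf =O[𝓟 (halfPlane δ)] fun _ : ℍ => (1 : ℝ) := by
    rw [isBigO_principal]; exact ⟨1, fun τ _ => by
      rw [Real.norm_of_nonneg (hb0 τ), norm_one, mul_one]; exact expDecayHalf_le_one τ⟩
  have pw : ∀ {m n : ℕ}, n ≤ m → (fun τ => expDecayHalf τ ^ m) =O[𝓟 (halfPlane δ)] fun τ => expDecayHalf τ ^ n := by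
    intro m n h
    rw [isBigO_principal]; exact ⟨1, fun τ _ => by
      rw [Real.norm_of_nonneg (pow_nonneg (hb0 τ) _), Real.norm_of_nonneg (pow_nonneg (hb0 τ) _), one_mul]
      exact pow_le_pow_of_le_one (hb0 τ) (expDecayHalf_le_one τ) h⟩
  have pw1 : ∀ {m : ℕ}, 1 ≤ m → (fun τ => expDecayHalf τ ^ m) =O[𝓟 (halfPlane δ)] expDecayHalf := fun h =>
    (pw h).congr_right fun τ => pow_one _
  have hq1 : qhalf =O[𝓟 (halfPlane δ)] fun _ : ℍ => (1 : ℝ) := hq.trans hb1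
  have one1 : (fun _ : ℍ => (1 : ℂ)) =O[𝓟 (halfPlane δ)] fun _ : ℍ => (1 : ℝ) := isBigO_const_const _ one_ne_zero _
  have bb : ∀ {u v : ℍ → ℂ}, u =O[𝓟 (halfPlane δ)] (fun _ : ℍ => (1 : ℝ)) → v =O[𝓟 (halfPlane δ)] (fun _ : ℍ => (1 : ℝ)) →
      (fun τ => u τ * v τ) =O[𝓟 (halfPlane δ)] fun _ : ℍ => (1 : ℝ) := fun hu hv => by simpa using hu.mul hv
  have hq2 : (fun τ => qhalf τ ^ 2) =O[𝓟 (halfPlane δ)] fun _ : ℍ => (1 : ℝ) := by simpa [sq] using bb hq1 hq1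
  have hq3 : (fun τ => qhalf τ ^ 3) =O[𝓟 (halfPlane δ)] fun _ : ℍ => (1 : ℝ) := by simpa [pow_succ] using bb hq2 hq1
  have hq3e : (fun τ => qhalf τ ^ 3) =O[𝓟 (halfPlane δ)] expDecayHalf := by
    simpa [pow_succ] using (bb hq1 hq1).mul hq
  have hq2e2 : (fun τ => qhalf τ ^ 2) =O[𝓟 (halfPlane δ)] fun τ => expDecayHalf τ ^ 2 := by simpa using hq.pow 2
  have hq3e2 : (fun τ => qhalf τ ^ 3) =O[𝓟 (halfPlane δ)] fun τ => expDecayHalf τ ^ 2 := by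
    simpa [pow_succ, sq] using (hq1.mul hq).mul hq
  have polyq : ∀ (a b c d : ℂ), (fun τ => a + b * qhalf τ + c * qhalf τ ^ 2 + d * qhalf τ ^ 3) =O[𝓟 (halfPlane δ)] fun _ : ℍ => (1 : ℝ) := by
    intro a b c d
    by_cases ha : a = 0
    · subst ha
      have := ((hq1.const_mul_left b).add (hq2.const_mul_left c)).add (hq3.const_mul_left d)
      exact this.congr_left fun τ => by ring
    · exact (((isBigO_const_const a one_ne_zero _).add (hq1.const_mul_left b)).add (hq2.const_mul_left c)).add (hq3.const_mul_left d)
  -- U, W bounded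
  have hU1 : thetaU =O[𝓟 (halfPlane δ)] fun _ : ℍ => (1 : ℝ) := by
    have := (rU.trans (pw (Nat.zero_le 4)) |>.congr_right fun τ => pow_zero _).add (polyq 1 8 24 32)
    exact this.congr_left fun τ => by ring
  have hW1 : thetaW =O[𝓟 (halfPlane δ)] fun _ : ℍ => (1 : ℝ) := by
    have := (rW.trans (pw (Nat.zero_le 4)) |>.congr_right fun τ => pow_zero _).add (polyq 1 (-8) 24 (-32))
    exact this.congr_left fun τ => by ring
  -- V, U − W, 𝓛_S = O(b)
  have hVb : thetaV =O[𝓟 (halfPlane δ)] expDecayHalf := by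
    have := ((rV.trans (pw1 (by norm_num))).add (hq.const_mul_left 16)).add (hq3e.const_mul_left 64)
    exact this.congr_left fun τ => by ring
  have hUWb : (fun τ => thetaU τ - thetaW τ) =O[𝓟 (halfPlane δ)] expDecayHalf := by
    have := (((rU.trans (pw1 (by norm_num))).sub (rW.trans (pw1 (by norm_num)))).add (hq.const_mul_left 16)).add (hq3e.const_mul_left 64)
    exact this.congr_left fun τ => by ring
  have hSb : logLambdaS =O[𝓟 (halfPlane δ)] expDecayHalf := by
    have := (rS.trans (pw1 (by norm_num))).sub (hq.const_mul_left 16)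
    exact this.congr_left fun τ => by ring
  have hM1 : logLambdaPer =O[𝓟 (halfPlane δ)] fun _ : ℍ => (1 : ℝ) := by
    have := (rM.trans (pw (Nat.zero_le 3)) |>.congr_right fun τ => pow_zero _).add (polyq ((Real.log 16 : ℝ) : ℂ) (-8) 12 0)
    exact this.congr_left fun τ => by ring
  -- ξ's
  have hV1 : thetaV =O[𝓟 (halfPlane δ)] fun _ : ℍ => (1 : ℝ) := hVb.trans hb1
  have hxi2 : xi2 =O[𝓟 (halfPlane δ)] fun _ : ℍ => (1 : ℝ) := (hU1.add hW1).congr_left fun τ => by simp [xi2]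
  have hxi4 : xi4 =O[𝓟 (halfPlane δ)] fun _ : ℍ => (1 : ℝ) := by
    have := ((bb hU1 hU1).add (bb hW1 hW1)).sub ((bb hV1 hV1).const_mul_left 2)
    exact this.congr_left fun τ => by simp only [xi4, Pi.add_apply, Pi.sub_apply, Pi.mul_apply, Pi.smul_apply, smul_eq_mul]
  have hxi2S : xi2S =O[𝓟 (halfPlane δ)] fun _ : ℍ => (1 : ℝ) := (hU1.add hV1).neg_left.congr_left fun τ => by
    simp only [xi2S, Pi.add_apply, Pi.neg_apply]
  have hxi4S : xi4S =O[𝓟 (halfPlane δ)] fun _ : ℍ => (1 : ℝ) := by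
    have := ((bb hU1 hU1).add (bb hV1 hV1)).sub ((bb hW1 hW1).const_mul_left 2)
    exact this.congr_left fun τ => by simp only [xi4S, Pi.add_apply, Pi.sub_apply, Pi.mul_apply, Pi.smul_apply, smul_eq_mul]
  -- `ξ₂ − ξ₄ = O(b²)`: as in `KernelBoundsMinus8.xi2_sub_xi4_isBigO` (second order suffices)
  have hU2 : (fun τ => thetaU τ - 1 - 8 * qhalf τ) =O[𝓟 (halfPlane δ)] fun τ => expDecayHalf τ ^ 2 := by
    have := ((rU.trans (pw (by norm_num : 2 ≤ 4))).add (hq2e2.const_mul_left 24)).add (hq3e2.const_mul_left 32)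
    exact this.congr_left fun τ => by ring
  have hW2 : (fun τ => thetaW τ - 1 + 8 * qhalf τ) =O[𝓟 (halfPlane δ)] fun τ => expDecayHalf τ ^ 2 := by
    have := ((rW.trans (pw (by norm_num : 2 ≤ 4))).add (hq2e2.const_mul_left 24)).sub (hq3e2.const_mul_left 32)
    exact this.congr_left fun τ => by ring
  have hV2 : (fun τ => thetaV τ - 16 * qhalf τ) =O[𝓟 (halfPlane δ)] fun τ => expDecayHalf τ ^ 2 := by
    have := (rV.trans (pw (by norm_num : 2 ≤ 5))).add (hq3e2.const_mul_left 64)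
    exact this.congr_left fun τ => by ring
  have hqq : (fun τ => qhalf τ * qhalf τ) =O[𝓟 (halfPlane δ)] fun τ => expDecayHalf τ ^ 2 := by simpa [sq] using hq.mul hq
  have hx24 : (fun τ => xi2 τ - xi4 τ) =O[𝓟 (halfPlane δ)] fun τ => expDecayHalf τ ^ 2 := by
    -- same decomposition as `xi2_sub_xi4_isBigO`
    have hform : ∀ τ : ℍ, xi2 τ - xi4 τ =
        -((thetaU τ - 1 - 8 * qhalf τ) * (thetaU τ - 8 * qhalf τ) + (thetaW τ - 1 + 8 * qhalf τ) * (thetaW τ + 8 * qhalf τ))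
          - 16 * qhalf τ * ((thetaU τ - 1 - 8 * qhalf τ) - (thetaW τ - 1 + 8 * qhalf τ))
          + 384 * (qhalf τ * qhalf τ)
          + 2 * (thetaV τ - 16 * qhalf τ) * ((thetaV τ - 16 * qhalf τ) + 32 * qhalf τ) := by
      intro τ
      simp only [xi2, xi4, Pi.add_apply, Pi.sub_apply, Pi.mul_apply, Pi.smul_apply, smul_eq_mul]; ring
    have t1 : (fun τ => (thetaU τ - 1 - 8 * qhalf τ) * (thetaU τ - 8 * qhalf τ)) =O[𝓟 (halfPlane δ)] fun τ => expDecayHalf τ ^ 2 := by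
      simpa using hU2.mul (hU1.sub (hq1.const_mul_left 8))
    have t2 : (fun τ => (thetaW τ - 1 + 8 * qhalf τ) * (thetaW τ + 8 * qhalf τ)) =O[𝓟 (halfPlane δ)] fun τ => expDecayHalf τ ^ 2 := by
      simpa using hW2.mul (hW1.add (hq1.const_mul_left 8))
    have t3 : (fun τ => 16 * qhalf τ * ((thetaU τ - 1 - 8 * qhalf τ) - (thetaW τ - 1 + 8 * qhalf τ))) =O[𝓟 (halfPlane δ)]
        fun τ => expDecayHalf τ ^ 2 := by
      have := (hq1.mul (hU2.sub hW2)).const_mul_left 16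
      simpa [mul_assoc] using this
    have t4 : (fun τ => 2 * (thetaV τ - 16 * qhalf τ) * ((thetaV τ - 16 * qhalf τ) + 32 * qhalf τ)) =O[𝓟 (halfPlane δ)]
        fun τ => expDecayHalf τ ^ 2 := by
      have hb : (fun τ => (thetaV τ - 16 * qhalf τ) + 32 * qhalf τ) =O[𝓟 (halfPlane δ)] fun _ : ℍ => (1 : ℝ) :=
        (hV1.sub (hq1.const_mul_left 16)).add (hq1.const_mul_left 32)
      have := (hV2.mul hb).const_mul_left 2
      simpa [mul_assoc] using this
    exact ((((t1.add t2).neg_left.sub t3).add (hqq.const_mul_left 384)).add t4).congr' (Eventually.of_forall fun τ => by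
      beta_reduce; rw [hform τ]) EventuallyEq.rfl
  have hx24S : (fun τ => xi2S τ - xi4S τ) =O[𝓟 (halfPlane δ)] expDecayHalf := by
    have hu : (fun τ => thetaU τ - 1) =O[𝓟 (halfPlane δ)] expDecayHalf := by
      have := (hU2.trans (pw1 (by norm_num))).add (hq.const_mul_left 8); exact this.congr_left fun τ => by ring
    have hw : (fun τ => thetaW τ - 1) =O[𝓟 (halfPlane δ)] expDecayHalf := by
      have := (hW2.trans (pw1 (by norm_num))).sub (hq.const_mul_left 8); exact this.congr_left fun τ => by ring
    have hform : ∀ τ : ℍ, xi2S τ - xi4S τ =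
        -3 * (thetaU τ - 1) - thetaV τ - (thetaU τ - 1) * (thetaU τ - 1) - thetaV τ * thetaV τ +
          4 * (thetaW τ - 1) + 2 * ((thetaW τ - 1) * (thetaW τ - 1)) := by
      intro τ
      simp only [xi2S, xi4S, Pi.add_apply, Pi.sub_apply, Pi.mul_apply, Pi.neg_apply, Pi.smul_apply, smul_eq_mul]; ring
    have hu1 := hu.trans hb1
    have hw1 := hw.trans hb1
    have t3 : (fun τ => (thetaU τ - 1) * (thetaU τ - 1)) =O[𝓟 (halfPlane δ)] expDecayHalf := by simpa using hu1.mul hu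
    have t4 : (fun τ => thetaV τ * thetaV τ) =O[𝓟 (halfPlane δ)] expDecayHalf := by simpa using hV1.mul hVb
    have t6 : (fun τ => 2 * ((thetaW τ - 1) * (thetaW τ - 1))) =O[𝓟 (halfPlane δ)] expDecayHalf := by
      simpa using (hw1.mul hw).const_mul_left 2
    exact ((((((hu.const_mul_left (-3)).sub hVb).sub t3).sub t4).add (hw.const_mul_left 4)).add t6).congr'
      (Eventually.of_forall fun τ => by beta_reduce; rw [hform τ]) EventuallyEq.rfl
  exact ⟨hU1, hW1, hVb, hUWb, hSb, hM1, hx24, hx24S, hxi2, hxi4, hxi2S, hxi4S⟩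

/-! ## The rows `ψ₂, ψ₄` and their slashes on half-planes -/

/-- `ψ₂, ψ₄ = O(|τ|)`, `ψ₂ − ψ₄ = O(|τ|e^{−2π Im τ})`, and the slashed row differences
`(ψ₂ + πiξ₂) − (ψ₄ + πiξ₄) = O(|τ|e^{−2π Im τ})`, `(ψ₂ + πiξ₂|S) − (ψ₄ + πiξ₄|S) = O(|τ|e^{−π Im τ})`,
uniformly on `Im τ ≥ δ`. [cite: CohnEtAl2019, Lemma 4.9 (proof)] -/
theorem halfPlane_isBigO_psi {δ : ℝ} (hδ : 0 < δ) :
    (psi4 =O[𝓟 (halfPlane δ)] fun τ : ℍ => ‖(τ : ℂ)‖) ∧ (psi2 =O[𝓟 (halfPlane δ)] fun τ : ℍ => ‖(τ : ℂ)‖) ∧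
    ((fun τ => psi2 τ - psi4 τ) =O[𝓟 (halfPlane δ)] fun τ : ℍ => ‖(τ : ℂ)‖ * expDecayHalf τ ^ 2) ∧
    ((fun τ => (psi2 + (π * I) • xi2) τ - (psi4 + (π * I) • xi4) τ) =O[𝓟 (halfPlane δ)] fun τ : ℍ => ‖(τ : ℂ)‖ * expDecayHalf τ ^ 2) ∧
    ((fun τ => (psi2 + (π * I) • xi2S) τ - (psi4 + (π * I) • xi4S) τ) =O[𝓟 (halfPlane δ)] fun τ : ℍ => ‖(τ : ℂ)‖ * expDecayHalf τ ^ 1) ∧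
    ((psi4 + (π * I) • xi4) =O[𝓟 (halfPlane δ)] fun τ : ℍ => ‖(τ : ℂ)‖) ∧
    ((psi4 + (π * I) • xi4S) =O[𝓟 (halfPlane δ)] fun τ : ℍ => ‖(τ : ℂ)‖) := by
  obtain ⟨hU1, hW1, hVb, hUWb, hSb, hM1, hx24, hx24S, hxi2, hxi4, hxi2S, hxi4S⟩ := halfPlane_isBigO_theta hδ
  obtain ⟨_, _, _, _, _, _, _, h1, hcoe, _⟩ := halfPlane_isBigO_basic hδ
  have hb0 : ∀ τ : ℍ, 0 ≤ expDecayHalf τ := fun τ => (expDecayHalf_pos τ).le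
  have hb1 : expDecayHalf =O[𝓟 (halfPlane δ)] fun _ : ℍ => (1 : ℝ) := by
    rw [isBigO_principal]; exact ⟨1, fun τ _ => by
      rw [Real.norm_of_nonneg (hb0 τ), norm_one, mul_one]; exact expDecayHalf_le_one τ⟩
  -- `𝓛 = πiτ + M = O(|τ|)`
  have hL : logLambda =O[𝓟 (halfPlane δ)] fun τ : ℍ => ‖(τ : ℂ)‖ := by
    have t1 : (fun τ : ℍ => (π * I * τ : ℂ)) =O[𝓟 (halfPlane δ)] fun τ : ℍ => ‖(τ : ℂ)‖ := by
      simpa using hcoe.const_mul_left (π * I : ℂ)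
    have t2 : logLambdaPer =O[𝓟 (halfPlane δ)] fun τ : ℍ => ‖(τ : ℂ)‖ := by simpa using h1.mul hM1
    exact (t1.add t2).congr_left fun τ => by simp [logLambdaPer]
  have hS1 : logLambdaS =O[𝓟 (halfPlane δ)] fun τ : ℍ => ‖(τ : ℂ)‖ := by simpa using h1.mul (hSb.trans hb1)
  -- generic: bounded × O(|τ|)
  have bL : ∀ {u : ℍ → ℂ}, u =O[𝓟 (halfPlane δ)] (fun _ : ℍ => (1 : ℝ)) →
      (fun τ => u τ * logLambda τ) =O[𝓟 (halfPlane δ)] fun τ : ℍ => ‖(τ : ℂ)‖ := fun hu => by simpa using hu.mul hL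
  have bS : ∀ {u : ℍ → ℂ}, u =O[𝓟 (halfPlane δ)] (fun _ : ℍ => (1 : ℝ)) →
      (fun τ => u τ * logLambdaS τ) =O[𝓟 (halfPlane δ)] fun τ : ℍ => ‖(τ : ℂ)‖ := fun hu => by simpa using hu.mul hS1
  have hψ4 : psi4 =O[𝓟 (halfPlane δ)] fun τ : ℍ => ‖(τ : ℂ)‖ :=
    ((bL hxi4).add (bS hxi4S)).congr_left fun τ => by simp [psi4]
  have hψ2 : psi2 =O[𝓟 (halfPlane δ)] fun τ : ℍ => ‖(τ : ℂ)‖ :=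
    ((bL hxi2).add (bS hxi2S)).congr_left fun τ => by simp [psi2]
  -- `(ξ₂ − ξ₄)𝓛 + (ξ₂|S − ξ₄|S)𝓛_S`
  have hd : (fun τ => psi2 τ - psi4 τ) =O[𝓟 (halfPlane δ)] fun τ : ℍ => ‖(τ : ℂ)‖ * expDecayHalf τ ^ 2 := by
    have t1 : (fun τ => (xi2 τ - xi4 τ) * logLambda τ) =O[𝓟 (halfPlane δ)] fun τ : ℍ => ‖(τ : ℂ)‖ * expDecayHalf τ ^ 2 :=
      (hx24.mul hL).congr_right fun τ => by ring
    have t2 : (fun τ => (xi2S τ - xi4S τ) * logLambdaS τ) =O[𝓟 (halfPlane δ)] fun τ : ℍ => ‖(τ : ℂ)‖ * expDecayHalf τ ^ 2 := by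
      have h := hx24S.mul hSb
      have h' : (fun τ => (xi2S τ - xi4S τ) * logLambdaS τ) =O[𝓟 (halfPlane δ)] fun τ => expDecayHalf τ ^ 2 :=
        h.congr_right fun τ => by ring
      refine h'.trans ?_
      rw [isBigO_principal]
      refine ⟨1 / δ, fun τ hτ => ?_⟩
      have hτ1 : δ ≤ ‖(τ : ℂ)‖ := (mem_halfPlane.1 hτ).trans (im_le_norm_coe τ)
      rw [Real.norm_of_nonneg (pow_nonneg (hb0 τ) 2), Real.norm_of_nonneg (mul_nonneg (norm_nonneg _) (pow_nonneg (hb0 τ) 2)),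
        one_div, ← mul_assoc, inv_mul_eq_div]
      exact le_mul_of_one_le_left (pow_nonneg (hb0 τ) 2) (by rw [le_div_iff₀ hδ, one_mul]; exact hτ1)
    exact (t1.add t2).congr_left fun τ => by simp only [psi2, psi4, Pi.add_apply, Pi.mul_apply]; ring
  -- `πi(ξ₂ − ξ₄) = O(b²) ⊂ O(|τ| b²)` and `πi(ξ₂|S − ξ₄|S) = O(b) ⊂ O(|τ| b)`
  have upτ : ∀ {f : ℍ → ℂ} {k : ℕ}, f =O[𝓟 (halfPlane δ)] (fun τ => expDecayHalf τ ^ k) →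
      f =O[𝓟 (halfPlane δ)] fun τ : ℍ => ‖(τ : ℂ)‖ * expDecayHalf τ ^ k := by
    intro f k hf
    refine hf.trans ?_
    rw [isBigO_principal]
    refine ⟨1 / δ, fun τ hτ => ?_⟩
    have hτ1 : δ ≤ ‖(τ : ℂ)‖ := (mem_halfPlane.1 hτ).trans (im_le_norm_coe τ)
    rw [Real.norm_of_nonneg (pow_nonneg (hb0 τ) k), Real.norm_of_nonneg (mul_nonneg (norm_nonneg _) (pow_nonneg (hb0 τ) k)),
      one_div, ← mul_assoc, inv_mul_eq_div]
    exact le_mul_of_one_le_left (pow_nonneg (hb0 τ) k) (by rw [le_div_iff₀ hδ, one_mul]; exact hτ1)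
  have hdT : (fun τ => (psi2 + (π * I) • xi2) τ - (psi4 + (π * I) • xi4) τ) =O[𝓟 (halfPlane δ)]
      fun τ : ℍ => ‖(τ : ℂ)‖ * expDecayHalf τ ^ 2 := by
    have := hd.add (upτ (hx24.const_mul_left (π * I : ℂ)))
    exact this.congr_left fun τ => by simp only [Pi.add_apply, Pi.smul_apply, smul_eq_mul]; ring
  have hdTS : (fun τ => (psi2 + (π * I) • xi2S) τ - (psi4 + (π * I) • xi4S) τ) =O[𝓟 (halfPlane δ)]
      fun τ : ℍ => ‖(τ : ℂ)‖ * expDecayHalf τ ^ 1 := by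
    have hd1 : (fun τ => psi2 τ - psi4 τ) =O[𝓟 (halfPlane δ)] fun τ : ℍ => ‖(τ : ℂ)‖ * expDecayHalf τ ^ 1 := by
      refine hd.trans ?_
      rw [isBigO_principal]
      refine ⟨1, fun τ _ => ?_⟩
      rw [Real.norm_of_nonneg (mul_nonneg (norm_nonneg _) (pow_nonneg (hb0 τ) 2)),
        Real.norm_of_nonneg (mul_nonneg (norm_nonneg _) (pow_nonneg (hb0 τ) 1)), one_mul, pow_one, sq]
      exact mul_le_mul_of_nonneg_left (mul_le_of_le_one_left (hb0 τ) (expDecayHalf_le_one τ)) (norm_nonneg _)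
    have hx1 : (fun τ => xi2S τ - xi4S τ) =O[𝓟 (halfPlane δ)] fun τ => expDecayHalf τ ^ 1 := hx24S.congr_right fun τ => (pow_one _).symm
    have := hd1.add (upτ (hx1.const_mul_left (π * I : ℂ)))
    exact this.congr_left fun τ => by simp only [Pi.add_apply, Pi.smul_apply, smul_eq_mul]; ring
  have h4T : (psi4 + (π * I) • xi4) =O[𝓟 (halfPlane δ)] fun τ : ℍ => ‖(τ : ℂ)‖ := by
    have hx : xi4 =O[𝓟 (halfPlane δ)] fun τ : ℍ => ‖(τ : ℂ)‖ := by simpa using h1.mul hxi4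
    exact (hψ4.add (hx.const_mul_left (π * I : ℂ))).congr_left fun τ => by simp [smul_eq_mul]
  have h4TS : (psi4 + (π * I) • xi4S) =O[𝓟 (halfPlane δ)] fun τ : ℍ => ‖(τ : ℂ)‖ := by
    have hx : xi4S =O[𝓟 (halfPlane δ)] fun τ : ℍ => ‖(τ : ℂ)‖ := by simpa using h1.mul hxi4S
    exact (hψ4.add (hx.const_mul_left (π * I : ℂ))).congr_left fun τ => by simp [smul_eq_mul]
  exact ⟨hψ4, hψ2, hd, hdT, hdTS, h4T, h4TS⟩

/-! ## The uniform bound for general rows -/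

/-- **Master bound for rows `(1, R₂, R₄)`**: if `R₄ = O(|τ|)` and `R₂ − R₄ = O(|τ|e^{−kπ Im τ})`
(`k ≤ 2`) on `Im τ ≥ δ`, then `L_R(τ,z) = O(|τ| e^{−kπ Im τ} e^{−π Im z})` on `{Im τ ≥ δ} × {Im z ≥ δ}`.
[cite: CohnEtAl2019, Lemma 4.9 (proof)] -/
theorem minus8SBracket_isBigO {δ : ℝ} (hδ : 0 < δ) {R2 R4 : ℍ → ℂ} {k : ℕ} (hk : k ≤ 2)
    (h4 : R4 =O[𝓟 (halfPlane δ)] fun τ : ℍ => ‖(τ : ℂ)‖)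
    (hd : (fun τ => R2 τ - R4 τ) =O[𝓟 (halfPlane δ)] fun τ : ℍ => ‖(τ : ℂ)‖ * expDecayHalf τ ^ k) :
    (fun p : ℍ × ℍ => minus8SBracket R2 R4 p.1 p.2) =O[𝓟 (halfPlane δ ×ˢ halfPlane δ)]
      fun p => ‖(p.1 : ℂ)‖ * expDecayHalf p.1 ^ k * expDecayHalf p.2 := by
  obtain ⟨hU1, hW1, hVb, hUWb, hSb, hM1, _, _, _, _, _, _⟩ := halfPlane_isBigO_theta hδ
  obtain ⟨hE4m, hE6m, _, hΔ, hE4, hE6, _, h1, hcoe, hq1⟩ := halfPlane_isBigO_basic hδ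
  obtain ⟨f1, _, _, f4, f5, _, _, _, z43, _, _⟩ := halfPlane_isBigO_factors hδ
  set F := 𝓟 (halfPlane δ ×ˢ halfPlane δ)
  have hb0 : ∀ τ : ℍ, 0 ≤ expDecayHalf τ := fun τ => (expDecayHalf_pos τ).le
  have bb : ∀ {u v : ℍ → ℂ}, u =O[𝓟 (halfPlane δ)] (fun _ : ℍ => (1 : ℝ)) → v =O[𝓟 (halfPlane δ)] (fun _ : ℍ => (1 : ℝ)) →
      (fun τ => u τ * v τ) =O[𝓟 (halfPlane δ)] fun _ : ℍ => (1 : ℝ) := fun hu hv => by simpa using hu.mul hv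
  -- `q = b² ≤ b^k` for `k ≤ 2`
  have hqk : expDecay =O[𝓟 (halfPlane δ)] fun τ => expDecayHalf τ ^ k := by
    rw [isBigO_principal]
    refine ⟨1, fun τ _ => ?_⟩
    rw [Real.norm_of_nonneg (expDecay_pos τ).le, Real.norm_of_nonneg (pow_nonneg (hb0 τ) k), one_mul, expDecay_eq_sq]
    exact pow_le_pow_of_le_one (hb0 τ) (expDecayHalf_le_one τ) hk
  have hΔk : (ModularForm.discriminant : ℍ → ℂ) =O[𝓟 (halfPlane δ)] fun τ => expDecayHalf τ ^ k := hΔ.trans hqk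
  -- `E₁₄ − E₄³ = O(q) ⊂ O(b^k)`
  have h143 : (fun τ : ℍ => E14fun τ - E₄ τ ^ 3) =O[𝓟 (halfPlane δ)] fun τ => expDecayHalf τ ^ k := by
    have h43 : (fun τ : ℍ => E₄ τ ^ 3 - 1) =O[𝓟 (halfPlane δ)] expDecay := z43
    exact ((f4.sub h43).congr_left fun τ => by ring).trans hqk
  -- `τ`-side: the three coefficient functions are `O(|τ| b^k)`
  have hA1 : (fun τ : ℍ => E₄ τ * ModularForm.discriminant τ) =O[𝓟 (halfPlane δ)] fun τ : ℍ => ‖(τ : ℂ)‖ * expDecayHalf τ ^ k := by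
    have := (h1.mul hE4).mul hΔk
    exact this.congr (fun τ => by ring) (fun τ => by ring)
  have hA2 : (fun τ : ℍ => R4 τ * ModularForm.discriminant τ) =O[𝓟 (halfPlane δ)] fun τ : ℍ => ‖(τ : ℂ)‖ * expDecayHalf τ ^ k :=
    h4.mul hΔk
  have hA3 : (fun τ : ℍ => (R2 τ - R4 τ) * E14fun τ + R4 τ * (E14fun τ - E₄ τ ^ 3)) =O[𝓟 (halfPlane δ)]
      fun τ : ℍ => ‖(τ : ℂ)‖ * expDecayHalf τ ^ k := by
    have t1 : (fun τ : ℍ => (R2 τ - R4 τ) * E14fun τ) =O[𝓟 (halfPlane δ)] fun τ : ℍ => ‖(τ : ℂ)‖ * expDecayHalf τ ^ k := by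
      simpa using hd.mul f5
    exact t1.add (h4.mul h143)
  -- `z`-side: `E₁₀𝓛_S, E₈V, g = −E₈V − E₆(U−W)(U+W)` are `O(b_z)`
  have hE8 : E8fun =O[𝓟 (halfPlane δ)] fun _ : ℍ => (1 : ℝ) := (bb hE4 hE4).congr_left fun z => by simp [E8fun]
  have hE10 : E10fun =O[𝓟 (halfPlane δ)] fun _ : ℍ => (1 : ℝ) := (bb hE4 hE6).congr_left fun z => by simp [E10fun]
  have g1 : (fun z : ℍ => E10fun z * logLambdaS z) =O[𝓟 (halfPlane δ)] expDecayHalf := by simpa using hE10.mul hSb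
  have g2 : (fun z : ℍ => E8fun z * thetaV z) =O[𝓟 (halfPlane δ)] expDecayHalf := by simpa using hE8.mul hVb
  have g3 : (fun z : ℍ => -(E8fun z * thetaV z) - E₆ z * ((thetaU z - thetaW z) * (thetaU z + thetaW z))) =O[𝓟 (halfPlane δ)]
      expDecayHalf := by
    have t : (fun z : ℍ => E₆ z * ((thetaU z - thetaW z) * (thetaU z + thetaW z))) =O[𝓟 (halfPlane δ)] expDecayHalf := by
      have := hE6.mul (hUWb.mul (hU1.add hW1))
      simpa using this
    exact g2.neg_left.sub t
  -- assemble on the product filter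
  have T : ∀ {a c : ℍ → ℂ}, a =O[𝓟 (halfPlane δ)] (fun τ : ℍ => ‖(τ : ℂ)‖ * expDecayHalf τ ^ k) →
      c =O[𝓟 (halfPlane δ)] expDecayHalf →
      (fun p : ℍ × ℍ => a p.1 * c p.2) =O[F] fun p => ‖(p.1 : ℂ)‖ * expDecayHalf p.1 ^ k * expDecayHalf p.2 := by
    intro a c ha hc
    exact (isBigO_fst_of_halfPlane ha).mul (isBigO_snd_of_halfPlane hc)
  have s1 := T hA1 g1
  have s2 := T hA2 g2
  have s3 := T hA3 g3
  have total := (((s1.const_mul_left (-2 * 1728 : ℂ)).sub (s2.const_mul_left (1728 : ℂ))).add s3).const_mul_left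
    (1 / (2 * 1728 * (π : ℂ)))
  refine total.congr_left fun p => ?_
  rw [minus8SBracket_decomp]
  ring

/-- Conversion of the master `O`-bound into the shape of (4.15)/(4.17). [folklore] -/
theorem minus8Kernel_S_bound_of_rows {δ : ℝ} (hδ : 0 < δ) {R2 R4 : ℍ → ℂ} {k : ℕ} (hk : k ≤ 2)
    (h4 : R4 =O[𝓟 (halfPlane δ)] fun τ : ℍ => ‖(τ : ℂ)‖)
    (hd : (fun τ => R2 τ - R4 τ) =O[𝓟 (halfPlane δ)] fun τ : ℍ => ‖(τ : ℂ)‖ * expDecayHalf τ ^ k) :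
    ∃ C : ℝ, ∀ τ z : ℍ, δ ≤ τ.im → δ ≤ z.im →
      ‖minus8Kernel R2 R4 τ (ModularGroup.S • z) * (z : ℂ) ^ 2 *
        (ModularForm.discriminant τ * ModularForm.discriminant z * (kleinJ τ - kleinJ z))‖
          ≤ C * (‖(τ : ℂ)‖ ^ 2 * ‖(z : ℂ)‖ ^ 2 * expDecayHalf τ ^ k * expDecayHalf z) := by
  obtain ⟨C, hC⟩ := isBigO_principal.1 (minus8SBracket_isBigO hδ hk h4 hd)
  refine ⟨|C| / δ ^ 3, fun τ z hτ hz => (norm_minus8Kernel_S_mul_le R2 R4 τ z).trans ?_⟩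
  have h := hC (τ, z) ⟨hτ, hz⟩
  have hb0 : ∀ σ : ℍ, 0 ≤ expDecayHalf σ := fun σ => (expDecayHalf_pos σ).le
  have hX0 : 0 ≤ ‖(τ : ℂ)‖ * expDecayHalf τ ^ k * expDecayHalf z :=
    mul_nonneg (mul_nonneg (norm_nonneg _) (pow_nonneg (hb0 τ) k)) (hb0 z)
  rw [Real.norm_of_nonneg hX0] at h
  refine h.trans ?_
  have hτ1 : δ ≤ ‖(τ : ℂ)‖ := hτ.trans (im_le_norm_coe τ)
  have hz1 : δ ≤ ‖(z : ℂ)‖ := hz.trans (im_le_norm_coe z)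
  have h1 : C * (‖(τ : ℂ)‖ * expDecayHalf τ ^ k * expDecayHalf z) ≤ |C| * (‖(τ : ℂ)‖ * expDecayHalf τ ^ k * expDecayHalf z) :=
    mul_le_mul_of_nonneg_right (le_abs_self C) hX0
  refine h1.trans ?_
  rw [show |C| / δ ^ 3 * (‖(τ : ℂ)‖ ^ 2 * ‖(z : ℂ)‖ ^ 2 * expDecayHalf τ ^ k * expDecayHalf z) =
    |C| * (‖(τ : ℂ)‖ * expDecayHalf τ ^ k * expDecayHalf z) * ((‖(τ : ℂ)‖ / δ) * (‖(z : ℂ)‖ / δ) ^ 2) by field_simp]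
  refine le_mul_of_one_le_right (mul_nonneg (abs_nonneg C) hX0) ?_
  have a : 1 ≤ ‖(τ : ℂ)‖ / δ := by rw [le_div_iff₀ hδ]; linarith
  have b : 1 ≤ ‖(z : ℂ)‖ / δ := by rw [le_div_iff₀ hδ]; linarith
  nlinarith [one_le_pow₀ (n := 2) b]

/-- The slashed rows for `γ = T, TS`. [cite: CohnEtAl2019, §4.2 Proposition 4.3] -/
theorem psi_rows_slash :
    (psi2 ∣[(2 : ℤ)] ModularGroup.T = psi2 + (π * I) • xi2 ∧ psi4 ∣[(4 : ℤ)] ModularGroup.T = psi4 + (π * I) • xi4) ∧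
    (psi2 ∣[(2 : ℤ)] (ModularGroup.T * ModularGroup.S) = psi2 + (π * I) • xi2S ∧
      psi4 ∣[(4 : ℤ)] (ModularGroup.T * ModularGroup.S) = psi4 + (π * I) • xi4S) := by
  refine ⟨⟨psi2_slash_T, psi4_slash_T⟩, ?_, ?_⟩
  · rw [SlashAction.slash_mul, psi2_slash_T, SlashAction.add_slash, SL_smul_slash, psi2_slash_S, xi2_slash_S]
  · rw [SlashAction.slash_mul, psi4_slash_T, SlashAction.add_slash, SL_smul_slash, psi4_slash_S, xi4_slash_S]

/-- **Lemma 4.9 (4.17) for `𝒦₋^{(8)}`** (multiplied-out form): on `Im τ, Im z ≥ δ`,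
`‖𝒦₋^{(8)}(τ,Sz)z²·Δ(τ)Δ(z)(j(τ)−j(z))‖ ≤ C|τ|²|z|²e^{−2π Im τ}e^{−π Im z}`. [cite: CohnEtAl2019, Lemma 4.9 (4.17)] -/
theorem kernelMinus8_S_bound_417 {δ : ℝ} (hδ : 0 < δ) : ∃ C : ℝ, ∀ τ z : ℍ, δ ≤ τ.im → δ ≤ z.im →
    ‖kernelMinus8 τ (ModularGroup.S • z) * (z : ℂ) ^ 2 *
      (ModularForm.discriminant τ * ModularForm.discriminant z * (kleinJ τ - kleinJ z))‖
        ≤ C * (‖(τ : ℂ)‖ ^ 2 * ‖(z : ℂ)‖ ^ 2 * expDecay τ * expDecayHalf z) := by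
  obtain ⟨hψ4, _, hd, _, _, _, _⟩ := halfPlane_isBigO_psi hδ
  obtain ⟨C, hC⟩ := minus8Kernel_S_bound_of_rows hδ le_rfl hψ4 hd
  refine ⟨C, fun τ z hτ hz => ?_⟩
  have := hC τ z hτ hz
  rw [kernelMinus8_eq_minus8Kernel]
  rwa [expDecay_eq_sq]

/-- **Lemma 4.9 (4.15) for `𝒦₋^{(8)}|₄γ`, `γ ∈ {I, T, TS}`** (multiplied-out form): on `Im τ, Im z ≥ δ`,
`‖(𝒦₋^{(8)}|₄γ)(τ,Sz)z²·Δ(τ)Δ(z)(j(τ)−j(z))‖ ≤ C|τ|²|z|²e^{−π Im τ}e^{−π Im z}`. [cite: CohnEtAl2019, Lemma 4.9 (4.15)] -/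
theorem kernelMinus8_S_bound_415 {δ : ℝ} (hδ : 0 < δ) (γ : SL(2, ℤ))
    (hγ : γ = 1 ∨ γ = ModularGroup.T ∨ γ = ModularGroup.T * ModularGroup.S) :
    ∃ C : ℝ, ∀ τ z : ℍ, δ ≤ τ.im → δ ≤ z.im →
      ‖((fun σ => kernelMinus8 σ (ModularGroup.S • z)) ∣[(4 : ℤ)] γ) τ * (z : ℂ) ^ 2 *
        (ModularForm.discriminant τ * ModularForm.discriminant z * (kleinJ τ - kleinJ z))‖
          ≤ C * (‖(τ : ℂ)‖ ^ 2 * ‖(z : ℂ)‖ ^ 2 * expDecayHalf τ * expDecayHalf z) := by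
  obtain ⟨hψ4, _, hd, hdT, hdTS, h4T, h4TS⟩ := halfPlane_isBigO_psi hδ
  have hb0 : ∀ σ : ℍ, 0 ≤ expDecayHalf σ := fun σ => (expDecayHalf_pos σ).le
  -- weaken `b²` to `b¹`
  have weak : ∀ {f : ℍ → ℂ}, f =O[𝓟 (halfPlane δ)] (fun τ : ℍ => ‖(τ : ℂ)‖ * expDecayHalf τ ^ 2) →
      f =O[𝓟 (halfPlane δ)] fun τ : ℍ => ‖(τ : ℂ)‖ * expDecayHalf τ ^ 1 := by
    intro f hf
    refine hf.trans ?_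
    rw [isBigO_principal]
    refine ⟨1, fun τ _ => ?_⟩
    rw [Real.norm_of_nonneg (mul_nonneg (norm_nonneg _) (pow_nonneg (hb0 τ) 2)),
      Real.norm_of_nonneg (mul_nonneg (norm_nonneg _) (pow_nonneg (hb0 τ) 1)), one_mul, pow_one, sq]
    exact mul_le_mul_of_nonneg_left (mul_le_of_le_one_left (hb0 τ) (expDecayHalf_le_one τ)) (norm_nonneg _)
  have main : ∀ {R2 R4 : ℍ → ℂ}, psi2 ∣[(2 : ℤ)] γ = R2 → psi4 ∣[(4 : ℤ)] γ = R4 →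
      R4 =O[𝓟 (halfPlane δ)] (fun τ : ℍ => ‖(τ : ℂ)‖) →
      (fun τ => R2 τ - R4 τ) =O[𝓟 (halfPlane δ)] (fun τ : ℍ => ‖(τ : ℂ)‖ * expDecayHalf τ ^ 1) →
      ∃ C : ℝ, ∀ τ z : ℍ, δ ≤ τ.im → δ ≤ z.im →
        ‖((fun σ => kernelMinus8 σ (ModularGroup.S • z)) ∣[(4 : ℤ)] γ) τ * (z : ℂ) ^ 2 *
          (ModularForm.discriminant τ * ModularForm.discriminant z * (kleinJ τ - kleinJ z))‖
            ≤ C * (‖(τ : ℂ)‖ ^ 2 * ‖(z : ℂ)‖ ^ 2 * expDecayHalf τ * expDecayHalf z) := by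
    intro R2 R4 e2 e4 hR4 hRd
    obtain ⟨C, hC⟩ := minus8Kernel_S_bound_of_rows hδ (by norm_num : 1 ≤ 2) hR4 hRd
    refine ⟨C, fun τ z hτ hz => ?_⟩
    have := hC τ z hτ hz
    rw [kernelMinus8_eq_minus8Kernel, minus8Kernel_slash, e2, e4]
    rwa [pow_one] at this
  rcases hγ with rfl | rfl | rfl
  · exact main (by rw [SlashAction.slash_one]) (by rw [SlashAction.slash_one]) hψ4 (weak hd)
  · obtain ⟨⟨hT2, hT4⟩, _, _⟩ := psi_rows_slash
    exact main hT2 hT4 h4T (weak hdT)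
  · obtain ⟨_, hS2, hS4⟩ := psi_rows_slash
    exact main hS2 hS4 h4TS hdTS

end Literature.NumberTheory.ModularForms
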